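import Literature.NumberTheory.Sieve.LinearEquationsInPrimesCountSandwich
import Mathlib.Analysis.SpecialFunctions.Pow.Asymptotics
import Mathlib.Analysis.SpecialFunctions.Log.Base
import Mathlib.Analysis.Complex.ExponentialBounds
import HarnessLib

/-!
# Linear equations in primes: from the von Mangoldt asymptotic to the prime-point count

Green–Tao's deduction "Conjecture 1.2 implies Conjecture 1.4" (B. Green, T. Tao, *Linear
equations in primes*, Ann. of Math. 171 (2010), §1, "Sketch proof of Conjecture 1.4 assuming
Conjecture 1.2", printed after (1.8)), proved here for an ARBITRARY CLASS `C` of systems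
(`primePointCount_asymptotic_of_vonMangoldtSum_asymptotic`): whenever the von Mangoldt asymptotic
`∑_{n ∈ K ∩ ℤ^d} ∏ᵢ Λ(ψᵢ(n)) = β_∞ ∏_p β_p + o_{t,d,L}(N^d)` holds uniformly over the nondegenerate
systems of `C` of size `‖Ψ‖_N ≤ L` and convex `K ⊆ [-N,N]^d`, so does the counting asymptotic (1.8)
`#{n ∈ K ∩ ℤ^d : ψᵢ(n) prime} = (1 + o(1)) β_∞ ∏_p β_p / log^t N + o(N^d / log^t N)` in the
`ε`-form of `GeneralizedHardyLittlewoodCount`. Two instances: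

* `C = ` finite complexity: the finite-complexity theorem `GreenTaoZiegler2012_finiteComplexity`
  (Green–Tao 2010 Main Theorem and Cor. 1.7, Green–Tao 2012, Green–Tao–Ziegler 2012; a named
  fact of `LinearEquationsInPrimes`) yields the prime-COUNTING asymptotic for systems of finite
  complexity (`primePointCount_asymptotic_of_finiteComplexity`, conditional on that named fact) —
  e.g. the number of `k`-term progressions of primes in counting form (Green–Tao 2010, Examples
  5–8);
* `C = ` all systems: Conjecture 1.2 implies Conjecture 1.4, i.e. the named fact
  `generalizedHardyLittlewood_count_of_vonMangoldt`; its discharge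
  `generalizedHardyLittlewood_count_of_vonMangoldt_holds` lives in
  `LinearEquationsInPrimesCountDeduction` (an independent, simultaneous formalisation of the same
  sketch with threshold `N^{1-ε/4t}`), and also follows from the class-general theorem here with
  `C = ⊤` in two lines. `GeneralizedHardyLittlewoodCount` itself (all complexities: prime
  tuples, twin primes) remains an open conjecture.

## The argument

Fix `d, t, L` and `ε`. For a scale `N` put `ℓ = log N` and `Y = N / ℓ^{t+1}`; call a lattice point
`n ∈ K ∩ ℤ^d` *good* if every `ψᵢ(n)` is a prime exceeding `Y`.
* (crude counts, `LinearEquationsInPrimesCountSandwich`) the points with some `|ψᵢ(n)| ≤ Y`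
  number `O(t Y N^{d-1})` and the points with some `ψᵢ(n)` a higher prime power number
  `O(t √(LN) log(LN) N^{d-1})`; both are `o(N^d / ℓ^t)` (`eventually_log_growth`:
  `log^{t+1} N = o(√N)`, `log log N = o(log N)`);
* (sandwich) on good points `∏ᵢ Λ(ψᵢ(n)) = ∏ᵢ log ψᵢ(n) ∈ [((1-η)ℓ)^t, ((1+η)ℓ)^t]` once
  `(t+1) log ℓ ≤ η ℓ` and `log (2L) ≤ η ℓ` (all values satisfy `|ψᵢ(n)| ≤ 2LN`), and every term
  is `≤ ((1+η)ℓ)^t`;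
* so `ℓ^t · #{prime points}` and `∑ ∏ Λ(ψᵢ(n))` differ by `O(η) · (main term) + o(N^d)`
  (`count_arith`), and the von Mangoldt asymptotic at precision `ε/8` gives the claim with
  `η = η(ε)` (`exists_eta_pow_near_one`). Green–Tao take `Y = N^{1-ε}` with `ε → 0` slowly;
  `Y = N / ℓ^{t+1}` only changes the bookkeeping.
The sign of the singular product is controlled through `∑ ∏ Λ ≥ 0`; no result beyond Mathlib is
used.

## References

* B. Green, T. Tao, *Linear equations in primes*, Ann. of Math. (2) 171 (2010), 1753–1850
  (arXiv:math/0606088), §1: Conj. 1.2, Conj. 1.4, (1.8) and its sketch proof, Main Theorem,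
  Cor. 1.7.
* B. Green, T. Tao, T. Ziegler, *An inverse theorem for the Gowers `U^{s+1}[N]`-norm*, Ann. of
  Math. (2) 176 (2012), 1231–1372, Thm. 1.3 and the paragraph following it.
-/

noncomputable section

open Filter Finset Asymptotics
open scoped Topology

namespace Literature.NumberTheory.Sieve

variable {d t : ℕ}

/-! ### Analytic inputs: growth of `log`, choice of `η` -/

/-- The elementary growth facts used to make the error terms small, at natural scales `N`:
eventually `C ≤ log N`, `(t+1) log log N ≤ η log N`, `log^{t+1} N ≤ c₁ N` and
`log^{t+1} N ≤ c₂ √N`. [folklore] -/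
theorem eventually_log_growth (t : ℕ) {η c₁ c₂ : ℝ} (C : ℝ) (hη : 0 < η) (hc₁ : 0 < c₁)
    (hc₂ : 0 < c₂) :
    ∀ᶠ N : ℕ in atTop, C ≤ Real.log N ∧
      (t + 1 : ℝ) * Real.log (Real.log N) ≤ η * Real.log N ∧
      Real.log N ^ (t + 1) ≤ c₁ * N ∧ Real.log N ^ (t + 1) ≤ c₂ * Real.sqrt N := by
  have h1 : ∀ᶠ x : ℝ in atTop, C ≤ Real.log x := Real.tendsto_log_atTop.eventually_ge_atTop C
  have h2 : ∀ᶠ x : ℝ in atTop, (t + 1 : ℝ) * Real.log (Real.log x) ≤ η * Real.log x := by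
    have ht1 : (0 : ℝ) < t + 1 := by positivity
    have := (Real.isLittleO_log_id_atTop.comp_tendsto Real.tendsto_log_atTop).bound
      (div_pos hη ht1)
    filter_upwards [this, Real.tendsto_log_atTop.eventually_ge_atTop 1] with x hx hx1
    simp only [Function.comp_apply, id_eq, Real.norm_eq_abs] at hx
    rw [abs_of_pos (by linarith : 0 < Real.log x)] at hx
    have h3 := le_abs_self (Real.log (Real.log x))
    calc (t + 1 : ℝ) * Real.log (Real.log x) ≤ (t + 1) * (η / (t + 1) * Real.log x) := by
          gcongr
          linarith
      _ = η * Real.log x := by field_simp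
  have h3 : ∀ᶠ x : ℝ in atTop, Real.log x ^ (t + 1) ≤ c₁ * x := by
    have := (Real.isLittleO_pow_log_id_atTop (n := t + 1)).bound hc₁
    filter_upwards [this, eventually_ge_atTop 1] with x hx hx1
    simp only [id_eq, Real.norm_eq_abs] at hx
    rwa [abs_of_nonneg (pow_nonneg (Real.log_nonneg hx1) _), abs_of_pos (by linarith)] at hx
  have h4 : ∀ᶠ x : ℝ in atTop, Real.log x ^ (t + 1) ≤ c₂ * Real.sqrt x := by
    have := (isLittleO_log_rpow_rpow_atTop ((t : ℝ) + 1) (by norm_num : (0 : ℝ) < 1 / 2)).bound hc₂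
    filter_upwards [this, eventually_ge_atTop 1] with x hx hx1
    rw [Real.norm_eq_abs, Real.norm_eq_abs, ← Real.sqrt_eq_rpow,
      abs_of_nonneg (Real.sqrt_nonneg _)] at hx
    have h5 : Real.log x ^ ((t : ℝ) + 1) = Real.log x ^ (t + 1) := by
      rw [← Real.rpow_natCast]
      push_cast
      ring_nf
    rw [h5, abs_of_nonneg (pow_nonneg (Real.log_nonneg hx1) _)] at hx
    exact hx
  exact tendsto_natCast_atTop_atTop.eventually (h1.and (h2.and (h3.and h4)))

/-- Choice of the relative precision `η`: `(1 ± η)^t` is within `δ` of `1` for small `η > 0`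
(continuity at `0`). [folklore] -/
theorem exists_eta_pow_near_one (t : ℕ) {δ : ℝ} (hδ : 0 < δ) :
    ∃ η : ℝ, 0 < η ∧ η ≤ 1 / 2 ∧ (1 + η) ^ t ≤ 1 + δ ∧ 1 - δ ≤ (1 - η) ^ t := by
  have h1 : Tendsto (fun η : ℝ => (1 + η) ^ t) (𝓝 0) (𝓝 1) := by
    have hc : Continuous fun η : ℝ => (1 + η) ^ t := by continuity
    simpa using hc.tendsto 0
  have h2 : Tendsto (fun η : ℝ => (1 - η) ^ t) (𝓝 0) (𝓝 1) := by
    have hc : Continuous fun η : ℝ => (1 - η) ^ t := by continuity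
    simpa using hc.tendsto 0
  have e1 : ∀ᶠ η : ℝ in 𝓝 0, (1 + η) ^ t ≤ 1 + δ :=
    h1.eventually (eventually_le_nhds (by linarith))
  have e2 : ∀ᶠ η : ℝ in 𝓝 0, 1 - δ ≤ (1 - η) ^ t :=
    h2.eventually (eventually_ge_nhds (by linarith))
  have e3 : ∀ᶠ η : ℝ in 𝓝 0, η ≤ 1 / 2 := eventually_le_nhds (by norm_num)
  obtain ⟨η, hη, hη0⟩ := (((e1.and (e2.and e3)).filter_mono
    (nhdsWithin_le_nhds (s := Set.Ioi (0 : ℝ)))).and self_mem_nhdsWithin).exists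
  exact ⟨η, hη0, hη.2.2, hη.1, hη.2.1⟩

/-- The real-arithmetic heart of the deduction: from the sandwich inequalities, Conjecture 1.2
at precision `ε₀/8` and the smallness of the error counts, the counting asymptotic at precision
`ε ≥ ε₀` follows. (`T = log^t N`, `lo = ((1-η) log N)^t`, `hi = ((1+η) log N)^t`,
`X = N^d`, `S = ∑ ∏ Λ`, `M = β_∞ ∏_p β_p`, `P = #{prime points}`.)
[cite: GreenTao2010, Conj. 1.4 (sketch proof)] -/
theorem count_arith {ε ε₀ T lo hi S M P g β γ X : ℝ} (hε₀ : 0 < ε₀) (hε₀1 : ε₀ ≤ 1)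
    (hε₀ε : ε₀ ≤ ε) (hT : 0 < T) (hX : 0 < X) (hlo : (1 - ε₀ / 4) * T ≤ lo)
    (hhi : hi ≤ (1 + ε₀ / 4) * T) (hg : 0 ≤ g) (hβ : 0 ≤ β) (hγ : 0 ≤ γ) (hS1 : lo * g ≤ S)
    (hS2 : S ≤ hi * (g + β + γ)) (hP1 : g ≤ P) (hP2 : P ≤ g + β) (hSM : |S - M| ≤ ε₀ / 8 * X)
    (hE : 2 * T * (β + γ) ≤ ε₀ / 8 * X) : |P - M / T| ≤ ε * (M + X) / T := by
  -- all steps are linear in the monomials `T g, T β, T γ, ε₀ T g, ε₀ S, ε₀ M, ε₀ X, ε₀² X, …`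
  have hTg : 0 ≤ T * g := mul_nonneg hT.le hg
  have hTβ0 : 0 ≤ T * β := mul_nonneg hT.le hβ
  have hTγ0 : 0 ≤ T * γ := mul_nonneg hT.le hγ
  have hε₀X : 0 ≤ ε₀ * X := mul_nonneg hε₀.le hX.le
  have hlo' : (1 - ε₀ / 4) * T * g ≤ lo * g := mul_le_mul_of_nonneg_right hlo hg
  have hlog : (1 - ε₀ / 4) * T * g ≤ S := hlo'.trans hS1
  have hpos : 0 ≤ (1 - ε₀ / 4) * (T * g) := mul_nonneg (by linarith) hTg
  have hS0 : 0 ≤ S := by linarith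
  have hSM1 : S - M ≤ ε₀ / 8 * X := (le_abs_self _).trans hSM
  have hSM2 : M - S ≤ ε₀ / 8 * X := by
    rw [abs_sub_comm] at hSM
    exact (le_abs_self _).trans hSM
  have hεTg : ε₀ * (T * g) ≤ 1 * (T * g) := mul_le_mul_of_nonneg_right hε₀1 hTg
  have h1 : T * g ≤ 2 * S := by linarith
  have h1ε : ε₀ * (T * g) ≤ ε₀ * (2 * S) := mul_le_mul_of_nonneg_left h1 hε₀.le
  have h2 : T * g - S ≤ ε₀ / 2 * S := by linarith
  have h3 : S - T * g ≤ ε₀ / 2 * S + 2 * T * (β + γ) := by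
    have hE0 : 0 ≤ g + β + γ := by linarith
    have hhi' : hi * (g + β + γ) ≤ (1 + ε₀ / 4) * T * (g + β + γ) :=
      mul_le_mul_of_nonneg_right hhi hE0
    have hβ' : ε₀ * (T * β) ≤ 1 * (T * β) := mul_le_mul_of_nonneg_right hε₀1 hTβ0
    have hγ' : ε₀ * (T * γ) ≤ 1 * (T * γ) := mul_le_mul_of_nonneg_right hε₀1 hTγ0
    linarith
  have hεS : ε₀ / 2 * S ≤ ε₀ / 2 * (M + ε₀ / 8 * X) :=
    mul_le_mul_of_nonneg_left (by linarith) (by linarith)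
  have hup : P * T - M ≤ ε₀ / 8 * X + ε₀ / 2 * (M + ε₀ / 8 * X) + T * β := by
    have hP2' : P * T ≤ (g + β) * T := mul_le_mul_of_nonneg_right hP2 hT.le
    linarith
  have hlow : M - P * T ≤ ε₀ / 8 * X + ε₀ / 2 * (M + ε₀ / 8 * X) + 2 * T * (β + γ) := by
    have hP1' : g * T ≤ P * T := mul_le_mul_of_nonneg_right hP1 hT.le
    linarith
  have hTβ : T * β ≤ ε₀ / 8 * X := by linarith
  have hM : -(ε₀ / 8 * X) ≤ M := by linarith
  have hMε : ε₀ * (-(ε₀ / 8 * X)) ≤ ε₀ * M := mul_le_mul_of_nonneg_left hM hε₀.le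
  have hεX : ε₀ * (ε₀ * X) ≤ 1 * (ε₀ * X) := mul_le_mul_of_nonneg_right hε₀1 hε₀X
  have hX1 : ε₀ * X ≤ 1 * X := mul_le_mul_of_nonneg_right hε₀1 hX.le
  have key : |P * T - M| ≤ ε₀ * (M + X) := by
    rw [abs_le]
    constructor
    · linarith
    · linarith
  have hMX : 0 ≤ M + X := by linarith
  have hPT : P - M / T = (P * T - M) / T := by field_simp
  rw [hPT, abs_div, abs_of_pos hT]
  exact div_le_div_of_nonneg_right (key.trans (mul_le_mul_of_nonneg_right hε₀ε hMX)) hT.le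

/-! ### From the von Mangoldt asymptotic to the prime-point count -/

/-- **Green–Tao's deduction, for an arbitrary class `C` of systems.** If the von Mangoldt
asymptotic `∑_{n ∈ K ∩ ℤ^d} ∏ᵢ Λ(ψᵢ(n)) = β_∞ ∏_p β_p + o_{t,d,L}(N^d)` holds uniformly over the
nondegenerate systems `Ψ` in `C` of size `‖Ψ‖_N ≤ L` and convex `K ⊆ [-N,N]^d`, then so does the
counting asymptotic (1.8),
`#{n ∈ K ∩ ℤ^d : ψᵢ(n) prime} = (1 + o(1)) β_∞ ∏_p β_p / log^t N + o(N^d / log^t N)`,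
in the `ε`-form of `GeneralizedHardyLittlewoodCount`. This is the "straightforward argument"
sketched by Green–Tao after (1.8) (with threshold `Y = N / log^{t+1} N` in place of their
`N^{1-ε}`, which only changes the bookkeeping); the class `C` is carried along unchanged.
[cite: GreenTao2010, Conj. 1.4 (sketch proof)] -/
theorem primePointCount_asymptotic_of_vonMangoldtSum_asymptotic
    (C : ∀ d t : ℕ, (Fin t → AffLinForm d) → Prop)
    (h : ∀ (d t L : ℕ), 1 ≤ d → 1 ≤ t → ∀ ε : ℝ, 0 < ε → ∃ N₀ : ℕ, ∀ N : ℕ, N₀ ≤ N →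
      ∀ Ψ : Fin t → AffLinForm d, IsNondegenerateSystem Ψ → C d t Ψ → affLinSize Ψ N ≤ L →
        ∀ K : Set (Fin d → ℝ), Convex ℝ K → K ⊆ realBox d N →
          |vonMangoldtSum Ψ K N - archFactor Ψ K * singularProduct Ψ| ≤ ε * (N : ℝ) ^ d)
    (d t L : ℕ) (hd : 1 ≤ d) (ht : 1 ≤ t) (ε : ℝ) (hε : 0 < ε) :
    ∃ N₀ : ℕ, ∀ N : ℕ, N₀ ≤ N →
      ∀ Ψ : Fin t → AffLinForm d, IsNondegenerateSystem Ψ → C d t Ψ → affLinSize Ψ N ≤ L →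
        ∀ K : Set (Fin d → ℝ), Convex ℝ K → K ⊆ realBox d N →
          |(primePointCount Ψ K N : ℝ) - archFactor Ψ K * singularProduct Ψ / Real.log N ^ t| ≤
            ε * (archFactor Ψ K * singularProduct Ψ + (N : ℝ) ^ d) / Real.log N ^ t := by
  obtain ⟨d, rfl⟩ : ∃ d', d = d' + 1 := ⟨d - 1, by omega⟩
  -- precision bookkeeping: `ε₀ = min ε 1`, `η = η(ε₀)`, Conjecture 1.2 at precision `ε₀ / 8`
  set ε₀ : ℝ := min ε 1 with hε₀def
  have hε₀ : 0 < ε₀ := lt_min hε one_pos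
  have hε₀1 : ε₀ ≤ 1 := min_le_right _ _
  have hε₀ε : ε₀ ≤ ε := min_le_left _ _
  have ht0 : (0 : ℝ) < t := by exact_mod_cast ht
  obtain ⟨η, hη0, hη2, hηp, hηm⟩ := exists_eta_pow_near_one t (δ := ε₀ / 4) (by positivity)
  obtain ⟨N₀, hN₀⟩ := h (d + 1) t L hd ht (ε₀ / 8) (by positivity)
  -- growth conditions on the scale
  have h3d : (0 : ℝ) < 3 ^ d := by positivity
  have hden : (0 : ℝ) < 128 * t * 3 ^ d * (Real.sqrt (2 * L) + 1) :=
    mul_pos (mul_pos (mul_pos (by norm_num) ht0) h3d) (by positivity)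
  set c₂ : ℝ := ε₀ / (128 * t * 3 ^ d * (Real.sqrt (2 * L) + 1)) with hc₂
  have hc₂0 : 0 < c₂ := div_pos hε₀ hden
  obtain ⟨N₁, hN₁⟩ := Filter.eventually_atTop.mp (eventually_log_growth t
    (max (Real.log (2 * L) / η) (96 * t * 3 ^ d / ε₀)) hη0 one_pos hc₂0)
  refine ⟨max N₀ (max N₁ 3), fun N hN Ψ hΨ hC hL K hK hKN => ?_⟩
  have hNN₀ : N₀ ≤ N := le_trans (le_max_left _ _) hN
  have hNN₁ : N₁ ≤ N := le_trans ((le_max_left _ _).trans (le_max_right _ _)) hN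
  have hN3 : 3 ≤ N := le_trans ((le_max_right _ _).trans (le_max_right _ _)) hN
  have hN1 : 1 ≤ N := by omega
  obtain ⟨hCℓ, hloglog, hℓpow, hℓsqrt⟩ := hN₁ N hNN₁
  have hx1 : (1 : ℝ) ≤ N := by exact_mod_cast hN1
  have hx3 : (3 : ℝ) ≤ N := by exact_mod_cast hN3
  have hx0 : (0 : ℝ) < N := by linarith
  -- `ℓ = log N > 1`
  have hℓ1 : 1 < Real.log N := by
    rw [Real.lt_log_iff_exp_lt hx0]
    linarith [Real.exp_one_lt_d9]
  set ℓ : ℝ := Real.log N with hℓdef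
  have hℓ0 : 0 < ℓ := by linarith
  have hℓt : 0 < ℓ ^ t := pow_pos hℓ0 t
  have hℓt1 : 0 < ℓ ^ (t + 1) := pow_pos hℓ0 _
  obtain ⟨i₀⟩ : Nonempty (Fin t) := ⟨⟨0, ht⟩⟩
  have hL1 : (1 : ℝ) ≤ L := one_le_of_affLinSize_le Ψ hΨ hL i₀
  have hlogL : Real.log (2 * L) ≤ η * ℓ := by
    have h1 : Real.log (2 * L) / η ≤ ℓ := (le_max_left _ _).trans hCℓ
    rw [div_le_iff₀ hη0] at h1
    linarith
  have hηℓ : η * ℓ ≤ 1 / 2 * ℓ := mul_le_mul_of_nonneg_right hη2 hℓ0.le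
  -- the threshold `Y = N / ℓ^{t+1}`
  set Y : ℝ := N / ℓ ^ (t + 1) with hYdef
  have hY1 : 1 ≤ Y := by
    rw [hYdef, le_div_iff₀ hℓt1, one_mul]
    linarith
  have hY0 : 0 < Y := by linarith
  have hlogY : (1 - η) * ℓ ≤ Real.log Y := by
    rw [hYdef, Real.log_div hx0.ne' hℓt1.ne', Real.log_pow, ← hℓdef]
    push_cast
    linarith
  have ha0 : 0 ≤ (1 - η) * ℓ := mul_nonneg (by linarith) hℓ0.le
  have hb : Real.log (2 * L * N) ≤ (1 + η) * ℓ := by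
    rw [Real.log_mul (by positivity) hx0.ne', ← hℓdef]
    linarith
  -- the sandwich and Conjecture 1.2
  obtain ⟨g, β, γ, hg, hβ, hγ, hS1, hS2, hP1, hP2, hβle, hγle⟩ :=
    vonMangoldtSum_primePointCount_sandwich hN1 Ψ hΨ hL K ht hY1 ha0 hlogY hb
  have hSM := hN₀ N hNN₀ Ψ hΨ hC hL K hK hKN
  simp only [Nat.add_sub_cancel] at hβle hγle
  -- smallness of the error counts
  have hxd : 0 < (N : ℝ) ^ d := pow_pos hx0 d
  have hQ : (2 * (N : ℝ) + 1) ^ d ≤ 3 ^ d * (N : ℝ) ^ d := by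
    rw [← mul_pow]
    exact pow_le_pow_left₀ (by linarith) (by linarith) d
  have hβ' : 2 * ℓ ^ t * β ≤ ε₀ / 16 * (N : ℝ) ^ (d + 1) := by
    have h96 : 96 * t * 3 ^ d ≤ ε₀ * ℓ := by
      have h1 : 96 * t * 3 ^ d / ε₀ ≤ ℓ := (le_max_right _ _).trans hCℓ
      rw [div_le_iff₀ hε₀] at h1
      linarith
    have hY3 : 2 * Y + 1 ≤ 3 * Y := by linarith
    have hℓY : ℓ * (ℓ ^ t * Y) = N := by
      rw [hYdef, pow_succ]
      field_simp
    have hℓtY : 0 ≤ ℓ ^ t * Y := by positivity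
    have h3 : 6 * t * 3 ^ d * (ℓ ^ t * Y) ≤ ε₀ / 16 * N := by
      have h1 : 96 * t * 3 ^ d * (ℓ ^ t * Y) ≤ ε₀ * ℓ * (ℓ ^ t * Y) :=
        mul_le_mul_of_nonneg_right h96 hℓtY
      have h2 : ε₀ * ℓ * (ℓ ^ t * Y) = ε₀ * N := by rw [← hℓY]; ring
      linarith
    calc 2 * ℓ ^ t * β
        ≤ 2 * ℓ ^ t * (t * ((2 * Y + 1) * (2 * (N : ℝ) + 1) ^ d)) := by gcongr
      _ ≤ 2 * ℓ ^ t * (t * (3 * Y * (3 ^ d * (N : ℝ) ^ d))) := by gcongr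
      _ = (N : ℝ) ^ d * (6 * t * 3 ^ d * (ℓ ^ t * Y)) := by ring
      _ ≤ (N : ℝ) ^ d * (ε₀ / 16 * N) := mul_le_mul_of_nonneg_left h3 hxd.le
      _ = ε₀ / 16 * (N : ℝ) ^ (d + 1) := by ring
  have hγ' : 2 * ℓ ^ t * γ ≤ ε₀ / 16 * (N : ℝ) ^ (d + 1) := by
    have hs : (Nat.sqrt (2 * L * N) : ℝ) ≤ Real.sqrt (2 * L) * Real.sqrt N := by
      have h1 := Real.nat_sqrt_le_real_sqrt (a := 2 * L * N)
      push_cast at h1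
      rwa [Real.sqrt_mul (by positivity)] at h1
    have hlg : (Nat.log 2 (2 * L * N) : ℝ) ≤ 4 * ℓ := by
      have h1 : ((Nat.log 2 (2 * L * N) : ℕ) : ℝ) ≤ Real.logb 2 (2 * L * N) := by
        have := Real.natLog_le_logb (2 * L * N) 2
        exact_mod_cast this
      have h2 : Real.logb 2 (2 * (L : ℝ) * N) ≤ 4 * ℓ := by
        rw [Real.logb, div_le_iff₀ (Real.log_pos one_lt_two)]
        have h3 : Real.log (2 * L * N) ≤ 2 * ℓ := hb.trans (by linarith)
        have h4 := Real.log_two_gt_d9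
        have h5 : 1 / 2 * ℓ ≤ Real.log 2 * ℓ := mul_le_mul_of_nonneg_right (by linarith) hℓ0.le
        linarith
      exact h1.trans h2
    have hsx : Real.sqrt N * Real.sqrt N = N := Real.mul_self_sqrt hx0.le
    have hsL : Real.sqrt (2 * L) ≤ Real.sqrt (2 * L) + 1 := by linarith
    have hkey : 8 * t * 3 ^ d * Real.sqrt (2 * L) * c₂ ≤ ε₀ / 16 := by
      rw [hc₂, mul_div_assoc', div_le_iff₀ hden]
      have : 8 * t * 3 ^ d * Real.sqrt (2 * L) * ε₀ ≤
          8 * t * 3 ^ d * (Real.sqrt (2 * L) + 1) * ε₀ := by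
        gcongr
      linarith
    calc 2 * ℓ ^ t * γ
        ≤ 2 * ℓ ^ t * (t * ((Nat.sqrt (2 * L * N) : ℝ) * (Nat.log 2 (2 * L * N) : ℝ) *
            (2 * (N : ℝ) + 1) ^ d)) := by gcongr
      _ ≤ 2 * ℓ ^ t * (t * (Real.sqrt (2 * L) * Real.sqrt N * (4 * ℓ) *
            (3 ^ d * (N : ℝ) ^ d))) := by
          gcongr
      _ = 8 * t * 3 ^ d * (N : ℝ) ^ d * Real.sqrt (2 * L) * Real.sqrt N * (ℓ ^ t * ℓ) := by
          ring
      _ ≤ 8 * t * 3 ^ d * (N : ℝ) ^ d * Real.sqrt (2 * L) * Real.sqrt N * (c₂ * Real.sqrt N) := by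
          refine mul_le_mul_of_nonneg_left ?_ (by positivity)
          rw [← pow_succ]
          exact hℓsqrt
      _ = 8 * t * 3 ^ d * Real.sqrt (2 * L) * c₂ * ((N : ℝ) ^ d * (Real.sqrt N * Real.sqrt N)) := by
          ring
      _ = 8 * t * 3 ^ d * Real.sqrt (2 * L) * c₂ * ((N : ℝ) ^ d * N) := by rw [hsx]
      _ ≤ ε₀ / 16 * ((N : ℝ) ^ d * N) := mul_le_mul_of_nonneg_right hkey (by positivity)
      _ = ε₀ / 16 * (N : ℝ) ^ (d + 1) := by ring
  have hE : 2 * ℓ ^ t * (β + γ) ≤ ε₀ / 8 * (N : ℝ) ^ (d + 1) := by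
    have : 2 * ℓ ^ t * (β + γ) = 2 * ℓ ^ t * β + 2 * ℓ ^ t * γ := by ring
    rw [this]
    linarith
  have hlo : (1 - ε₀ / 4) * ℓ ^ t ≤ ((1 - η) * ℓ) ^ t := by
    rw [mul_pow]
    exact mul_le_mul_of_nonneg_right hηm hℓt.le
  have hhi : ((1 + η) * ℓ) ^ t ≤ (1 + ε₀ / 4) * ℓ ^ t := by
    rw [mul_pow]
    exact mul_le_mul_of_nonneg_right hηp hℓt.le
  exact count_arith hε₀ hε₀1 hε₀ε hℓt (pow_pos hx0 (d + 1)) hlo hhi hg hβ hγ hS1 hS2 hP1 hP2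
    hSM hE

/-! ### The finite-complexity instance -/

/-- **The prime-counting asymptotic for systems of finite complexity** (Green–Tao 2010, Main
Theorem and Cor. 1.7 combined with the sketch proof of Conj. 1.4, made unconditional by
Green–Tao 2012 (`MN(s)`) and Green–Tao–Ziegler 2012 (`GI(s)`)), conditional here on the named
fact `GreenTaoZiegler2012_finiteComplexity` (the von Mangoldt form): uniformly over nondegenerate
systems of finite complexity of size `‖Ψ‖_N ≤ L` and convex `K ⊆ [-N, N]^d`,
`#{n ∈ K ∩ ℤ^d : ψ₁(n), …, ψ_t(n) prime} = (1 + o(1)) β_∞ ∏_p β_p / log^t N + o(N^d / log^t N)`.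
("In particular we can eliminate the first error term in (1.8) in this setting" — not done
here.) [cite: GreenTao2010, Main Theorem, Cor. 1.7 and Conj. 1.4 (sketch proof)] -/
theorem primePointCount_asymptotic_of_finiteComplexity
    (h : GreenTaoZiegler2012_finiteComplexity) :
    ∀ (d t L : ℕ), 1 ≤ d → 1 ≤ t → ∀ ε : ℝ, 0 < ε → ∃ N₀ : ℕ, ∀ N : ℕ, N₀ ≤ N →
      ∀ Ψ : Fin t → AffLinForm d, IsNondegenerateSystem Ψ → IsFiniteComplexitySystem Ψ →
        affLinSize Ψ N ≤ L →
        ∀ K : Set (Fin d → ℝ), Convex ℝ K → K ⊆ realBox d N →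
          |(primePointCount Ψ K N : ℝ) - archFactor Ψ K * singularProduct Ψ / Real.log N ^ t| ≤
            ε * (archFactor Ψ K * singularProduct Ψ + (N : ℝ) ^ d) / Real.log N ^ t :=
  primePointCount_asymptotic_of_vonMangoldtSum_asymptotic
    (fun _ _ Ψ => IsFiniteComplexitySystem Ψ) h

end Literature.NumberTheory.Sieve
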